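import Summits.BirchSwinnertonDyer.BirchSwinnertonDyer.Theses.TameQuarticManinParity
import Summits.BirchSwinnertonDyer.BirchSwinnertonDyer.Theorems.TameQuarticManinParityTameThreeOfColength
import Literature.NumberTheory.EllipticCurves.ModularJacobianNeronDifferentialsTameProofs
import HarnessLib

/-!
# Route `TameQuarticManinParity`, LINE 42 (bsd-idea-3 g12), glue G42 `TprimeTameThreeOfNeronCongruence`
# — N42 ∧ LP42 ⟹ E41, PROVED BY NAME (the planner's `ItemsInline42b.lean` / `Sketch42.lean`)

Cell `pub/bsd-wall`, D-0145 line `route-BirchSwinnertonDyer-TeichmullerTwistDescent`, seat `bsd-line-ttd-p1` g15.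
BSD is NOT proved by this; Manin's conjecture is not proved by this; the crux N42 (`TprimeIIINeronCongruenceSaturation`),
the print support LP42 (`CuspRegularFormsMemTameNeronLattice`) and the III cell E41 (`TprimeTameThreeOptimalManinUnit`,
24070) stay OPEN. This file closes ONLY the glue.

## Proof

`v₃(N) = 2` on the (t′) cell (`padicValNat_conductorNorm_eq_two_of_subTprime`, landed with G41a); LP42 puts the
cusp-regular witness `g` of N42 in the Néron lattice `Λ.lattice`; the carrier's `pullback_integral` gives
`deg φ·⟨f,g⟩ = t'·c·⟨f,f⟩` with `v₃(t') ≥ 0`; with `⟨f,g⟩ = t⟨f,f⟩`, `t ≠ 0`, `v₃(t) + v₃(deg φ) ≤ 0` and Petersson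
positivity, `v₃(c) ≤ 0`. THEOREMS ONLY; axioms `propext`, `Classical.choice`, `Quot.sound`.
-/

set_option autoImplicit false
-- D-0017: single-problem summit, so `Summit.BirchSwinnertonDyer.BirchSwinnertonDyer.…` repeats a namespace BY DESIGN.
set_option linter.dupNamespace false

namespace Summit.BirchSwinnertonDyer.BirchSwinnertonDyer.Theorems.TameQuarticManinParity

open scoped MatrixGroups ModularForm
open CongruenceSubgroup
open Summit.BirchSwinnertonDyer.BirchSwinnertonDyer.Theses.TameQuarticManinParity
open Literature.NumberTheory.EllipticCurves.ModularForms

/-- **Abbes–Ullmo at the Néron lattice**: a form `g ∈ L` with `⟨f,g⟩ = t⟨f,f⟩`, `t ≠ 0`, `v₃(t) + v₃(deg φ) ≤ 0`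
forces `3 ∤ c` for a lattice-optimal datum — `deg φ·⟨f,g⟩ = t'·c·⟨f,f⟩`, `v₃(t') ≥ 0` (`pullback_integral`).
[cite: AbbesUllmo1996, Lemme 3.1] [cite: CesnaviciusNeururerSaha2023, Lemma 7.1] -/
theorem not_dvd_maninConstant_of_latticeWitness {N : ℕ} [NeZero N] (Λ : TameNeronFormsAt N 3 8)
    {W : WeierstrassCurve ℚ} [W.IsElliptic] [W.IsGloballyMinimal] (D : ModularParametrizationData W N)
    (hopt : ∀ z ∈ D.L.lattice, ∃ w ∈ periodLattice D.f, z = D.c * w)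
    {g : CuspForm (Gamma0 N) 2} (hg : g ∈ Λ.lattice) {t : ℚ} (ht0 : t ≠ 0)
    (hv : padicValRat 3 t + padicValNat 3 D.modularDegree ≤ 0)
    (hfg : peterssonProduct (Gamma0 N) 2 D.f g = (t : ℂ) * peterssonProduct (Gamma0 N) 2 D.f D.f) :
    ¬ (3 : ℤ) ∣ D.maninConstant := by
  haveI : Fact (Nat.Prime 3) := ⟨Nat.prime_three⟩
  obtain ⟨t', ht', hpull⟩ := Λ.pullback_integral W D hopt g hg
  have hff : peterssonProduct (Gamma0 N) 2 D.f D.f ≠ 0 := by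
    intro h
    have hpos := peterssonProduct_self_pos_holds (Gamma0 N) 2 (IsNormalized.ne_zero D.isNewformOf.1.2.2)
    rw [h, Complex.zero_re] at hpos
    exact lt_irrefl _ hpos
  rw [hfg, ← mul_assoc] at hpull
  have hdeg : (D.modularDegree : ℂ) * (t : ℂ) = (t' : ℂ) * (D.maninConstant : ℂ) := mul_right_cancel₀ hff hpull
  have hdegQ : (D.modularDegree : ℚ) * t = t' * D.maninConstant := by exact_mod_cast hdeg
  have hd0 : (D.modularDegree : ℚ) ≠ 0 := by exact_mod_cast D.deg_pos.ne'
  have hc0 : (D.maninConstant : ℚ) ≠ 0 := by exact_mod_cast ModularParametrizationData.maninConstant_ne_zero_holds D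
  have ht'0 : t' ≠ 0 := by
    intro h; rw [h, zero_mul] at hdegQ; exact (mul_ne_zero hd0 ht0) hdegQ
  have hval : padicValRat 3 (D.modularDegree : ℚ) + padicValRat 3 t =
      padicValRat 3 t' + padicValRat 3 (D.maninConstant : ℚ) := by
    rw [← padicValRat.mul hd0 ht0, hdegQ, padicValRat.mul ht'0 hc0]
  rw [← padicValRat_of_nat, padicValRat.of_int] at hval
  intro h3
  have hc1 : 1 ≤ padicValInt 3 D.maninConstant := by
    rcases (padicValInt_dvd_iff (p := 3) 1 D.maninConstant).1 (by simpa using h3) with h0 | h1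
    · exact absurd h0 (ModularParametrizationData.maninConstant_ne_zero_holds D)
    · exact h1
  have : (1 : ℤ) ≤ padicValInt 3 D.maninConstant := by exact_mod_cast hc1
  push_cast at hval hv
  linarith

/-- **Glue G42** (`TprimeTameThreeOfNeronCongruence`), by name: N42 ∧ LP42 ⟹ E41 on the (t′) III cell.
[cite: AbbesUllmo1996, Lemme 3.1] [cite: CesnaviciusNeururerSaha2023, Thm. 5.15, Prop. 6.2, Thm. 6.12 (b)] -/
theorem tprimeTameThreeOfNeronCongruence_proof : TprimeTameThreeOfNeronCongruence := by
  unfold TprimeTameThreeOfNeronCongruence TprimeTameThreeOptimalManinUnit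
  intro h42 hLP W _ _ _ hadd ht h3 D hopt hmin hdeg
  obtain ⟨Λ, hΛ⟩ := hLP (W.conductorNorm ℤ) (padicValNat_conductorNorm_eq_two_of_subTprime W ht)
  obtain ⟨g, hrat, hreg, t, ht0, hv, hfg⟩ := h42 W hadd ht h3 D hopt hmin hdeg
  exact not_dvd_maninConstant_of_latticeWitness Λ D hopt (hΛ g hrat hreg) ht0 hv hfg

end Summit.BirchSwinnertonDyer.BirchSwinnertonDyer.Theorems.TameQuarticManinParity
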